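import Literature.AlgebraicGeometry.Resolution.SemiStablePairFieldBaseChange
import Literature.AlgebraicGeometry.Resolution.MarkedIdeals
import HarnessLib

/-!
# Simple normal crossings boundaries (BGMW form) are stable under extension of a perfect base field

Topic: `Literature/AlgebraicGeometry/Resolution`. Theorems only (no definition, no named fact).
Companion of `SemiStablePairFieldBaseChange.lean`, which proves that de Jong's strict normal
crossings divisors (`IsStrictNormalCrossingsDivisor`, Stacks 0BI9) pull back along
`Y ×_k Spec K → Y` for `Y` regular, locally of finite type over a perfect field `k` and any field
`K ⊇ k` (`IsStrictNormalCrossingsDivisor.preimage_pullback_fst_field`; Matsumura, *Commutative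
Ring Theory*, Thm. 15.1 with Thm. 23.7: along the flat local homomorphism
`𝒪_{Y,y} → 𝒪_{Y_K,p}` with regular closed fibre, a regular system of parameters of `𝒪_{Y,y}`
extends, by lifts of a regular system of parameters of the fibre ring, to one of `𝒪_{Y_K,p}`).
Here the SAME is proved for the Bierstone–Grigoriev–Milman–Włodarczyk boundary data used by the
tree's resolution files — a LIST of ideal sheaves `E` and a centre `C` with
`HasSNCWith E C` (`MarkedIdeals.lean`, BGMW 2011 Def. 3.1.1 / 3.1.3 (2): at every point a regular
system of parameters such that each member of `E` through the point has stalk ideal generated by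
ONE of the parameters, distinct members getting distinct parameters, and the centre by a subset
of them):

* `HasSNCWith.comap_pullback_fst_field` — **`HasSNCWith E C` on `Y` implies
  `HasSNCWith (E.map (·⁻¹)) (C⁻¹)` on `Y ×_k Spec K`**, the members pulled back as ideal sheaves
  (`Scheme.IdealSheafData.comap`); `HasSNC.comap_pullback_fst_field` — the case without centre.

Proof, at `p ∈ Y_K` over `y`: `𝒪_{Y_K,p}` is regular (`isRegularLocalRing_stalk_pullback_field`)
with regular closed fibre ring `F` (`isRegularLocalRing_fibreRing_pullback_fst`); the images of
the given parameters `u₁, …, u_d` of `𝒪_{Y,y}` together with lifts of a regular system of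
parameters of `F` generate `𝔪_p`, and `dim 𝒪_{Y_K,p} = d + dim F` (`ringKrullDim_eq_add_of_flat`),
so they form a regular system of parameters of `𝒪_{Y_K,p}`; the stalk of a pulled-back ideal sheaf
is the extension of the stalk (`stalkIdeal_comap_eq_map_stalkMap`), so the members of `E` through
`p` (= those through `y`, `support_comap`) and the centre are still generated by (subsets of)
the parameters.

Consumer: step S3′ of stub `GenericPropagation` of the crux line `padic-disc-transport`
(`Summits/HodgeConjecture/HodgeConjecture/Cruxes/VariationalHodge`): a log resolution with snc
boundary constructed over a countable field `k ⊂ ℂ` (`exists_logResolution_of_isClosed`,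
`HasSNC.exists_forall_smooth_strata`) is base-changed to `ℂ` and fed to the relative Ehresmann
theorem `HodgeTheory.isLocallyTrivialFibration_sncCompl`, whose hypothesis is `HasSNC`.

## Sources

* H. Matsumura, *Commutative Ring Theory* (1986), Thm. 15.1, Thm. 23.7. [Matsumura1987]
* E. Bierstone, D. Grigoriev, P. Milman, J. Włodarczyk, *Effective Hironaka resolution and its
  complexity*, Asian J. Math. 15 (2011), Def. 3.1.1, Def. 3.1.3 (2); §8 (étale / smooth base
  change of marked ideals). [BierstoneGrigorievMilmanWlodarczyk2011]
* The Stacks Project, Tag 00TV. [StacksProject]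
-/

noncomputable section

open CategoryTheory CategoryTheory.Limits AlgebraicGeometry TopologicalSpace IsLocalRing

namespace Literature.AlgebraicGeometry.Resolution

universe u

section SNCBaseChange

variable {k : Type u} [Field k] [PerfectField k] {Y : Scheme.{u}} (q : Y ⟶ Spec (.of k))
  [LocallyOfFiniteType q] (K : Type u) [Field K] [Algebra k K]

/-- **Simple normal crossings boundaries (BGMW form) are stable under extension of a perfect base
field.** For `Y` locally of finite type over a perfect field `k`, a list `E` of ideal sheaves and a
centre `C` with `HasSNCWith E C` (so `Y` is regular), and any field `K ⊇ k`, the pulled-back data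
on `Y ×_k Spec K` satisfy `HasSNCWith` again: at `p` over `y`, the images of the parameters of
`𝒪_{Y,y}` and lifts of a regular system of parameters of the (regular) closed fibre ring form a
regular system of parameters of the (regular) ring `𝒪_{Y_K,p}` (Matsumura 15.1, 23.7), and stalks
of pulled-back ideal sheaves are extended stalks. [cite: Matsumura1987, Thm. 15.1 and Thm. 23.7]
[cite: BierstoneGrigorievMilmanWlodarczyk2011, Def. 3.1.1 and Def. 3.1.3 (2)] -/
theorem HasSNCWith.comap_pullback_fst_field {E : List Y.IdealSheafData} {C : Y.IdealSheafData}
    (h : HasSNCWith E C) :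
    HasSNCWith (E.map fun D => D.comap (pullback.fst q (specOfAlgebra k K)))
      (C.comap (pullback.fst q (specOfAlgebra k K))) := by
  classical
  set P := pullback q (specOfAlgebra k K) with hP
  set fst := pullback.fst q (specOfAlgebra k K) with hfst
  haveI : Flat (specOfAlgebra k K) :=
    Flat.SpecMap_iff.mpr (RingHom.flat_algebraMap_iff.mpr inferInstance)
  haveI : Flat fst := inferInstance
  have hreg : ∀ y : Y, IsRegularLocalRing (Y.presheaf.stalk y) := fun y => (h y).1
  intro p
  obtain ⟨hregy, u, hu, ⟨ι, hι, hιD⟩, hC⟩ := h (fst p)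
  -- the flat local homomorphism `A = 𝒪_{Y,y} → B = 𝒪_{Y_K,p}`, its regular fibre ring `F`
  letI : Algebra (Y.presheaf.stalk (fst p)) (P.presheaf.stalk p) := (fst.stalkMap p).hom.toAlgebra
  haveI : Module.Flat (Y.presheaf.stalk (fst p)) (P.presheaf.stalk p) := Flat.stalkMap fst p
  haveI hφloc : IsLocalHom (algebraMap (Y.presheaf.stalk (fst p)) (P.presheaf.stalk p)) :=
    inferInstanceAs (IsLocalHom (fst.stalkMap p).hom)
  haveI : IsRegularLocalRing (Y.presheaf.stalk (fst p)) := hregy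
  haveI hBreg : IsRegularLocalRing (P.presheaf.stalk p) :=
    isRegularLocalRing_stalk_pullback_field q hreg K p
  haveI hFreg : IsRegularLocalRing (P.presheaf.stalk p ⧸ (maximalIdeal (Y.presheaf.stalk (fst p))).map
      (algebraMap (Y.presheaf.stalk (fst p)) (P.presheaf.stalk p))) :=
    isRegularLocalRing_fibreRing_pullback_fst q K p
  have hdimB := ringKrullDim_eq_add_of_flat (R := Y.presheaf.stalk (fst p)) (S := P.presheaf.stalk p)
  set φ := algebraMap (Y.presheaf.stalk (fst p)) (P.presheaf.stalk p) with hφ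
  set IF := (maximalIdeal (Y.presheaf.stalk (fst p))).map φ with hIF
  haveI hFloc : IsLocalRing (P.presheaf.stalk p ⧸ IF) := by rw [hIF]; infer_instance
  haveI hFreg' : IsRegularLocalRing (P.presheaf.stalk p ⧸ IF) := by rw [hIF]; exact hFreg
  -- dimensions: `dim A = d := spanFinrank 𝔪_A`, `dim F = eF`, `dim B = d + eF`
  have hdimA : ringKrullDim (Y.presheaf.stalk (fst p)) =
      ((maximalIdeal (Y.presheaf.stalk (fst p))).spanFinrank : WithBot ℕ∞) :=
    (IsRegularLocalRing.spanFinrank_maximalIdeal (R := Y.presheaf.stalk (fst p))).symm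
  obtain ⟨-, eF, w, hdimF, hspanF⟩ :=
    isRsopPart_of_isRegularLocalRing_zero (R := P.presheaf.stalk p ⧸ IF) Fin.elim0
  rw [Set.range_eq_empty, Set.empty_union] at hspanF
  rw [Nat.zero_add] at hdimF
  choose wl hwl using fun j => Ideal.Quotient.mk_surjective (I := IF) (w j)
  have hwl' : (Ideal.Quotient.mk IF) ∘ wl = w := funext hwl
  have hmA : IF = Ideal.span (Set.range (φ ∘ u)) := by
    rw [hIF, Set.range_comp, ← Ideal.map_span, hu]
  have hIFle : IF ≤ maximalIdeal (P.presheaf.stalk p) :=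
    ((local_hom_TFAE φ).out 0 2).mp hφloc
  -- `(φ u, wl)` generate `𝔪_B`
  have hgen : Ideal.span (Set.range (Fin.append (φ ∘ u) wl)) = maximalIdeal (P.presheaf.stalk p) := by
    rw [range_fin_append, Ideal.span_union, ← hmA]
    apply le_antisymm
    · refine sup_le hIFle ?_
      rw [Ideal.span_le]
      rintro _ ⟨j, rfl⟩
      rw [SetLike.mem_coe, mem_maximalIdeal_iff_mk_mem (I := IF), hwl, ← hspanF]
      exact Ideal.subset_span ⟨j, rfl⟩
    · intro m hm
      have h1 : Ideal.Quotient.mk IF m ∈ (Ideal.span (Set.range wl)).map (Ideal.Quotient.mk IF) := by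
        rw [Ideal.map_span, ← Set.range_comp, hwl', hspanF]
        exact (mem_maximalIdeal_iff_mk_mem (I := IF) m).mp hm
      have h2 : m ∈ ((Ideal.span (Set.range wl)).map (Ideal.Quotient.mk IF)).comap
          (Ideal.Quotient.mk IF) := h1
      rw [Ideal.comap_map_of_surjective _ Ideal.Quotient.mk_surjective, ← RingHom.ker_eq_comap_bot,
        Ideal.mk_ker] at h2
      rw [sup_comm]
      exact h2
  have hdimB' : ringKrullDim (P.presheaf.stalk p) =
      (((maximalIdeal (Y.presheaf.stalk (fst p))).spanFinrank + eF : ℕ) : WithBot ℕ∞) := by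
    rw [hdimB, hdimA, hdimF]
    push_cast
    rfl
  -- hence `spanFinrank 𝔪_B = d + eF` (`B` is regular)
  have heq : (maximalIdeal (P.presheaf.stalk p)).spanFinrank =
      (maximalIdeal (Y.presheaf.stalk (fst p))).spanFinrank + eF := by
    have h1 := IsRegularLocalRing.spanFinrank_maximalIdeal (R := P.presheaf.stalk p)
    rw [hdimB'] at h1
    exact_mod_cast h1
  -- the regular system of parameters of `B`, indexed by `Fin (spanFinrank 𝔪_B)`
  let g : Fin (maximalIdeal (P.presheaf.stalk p)).spanFinrank →
      Fin ((maximalIdeal (Y.presheaf.stalk (fst p))).spanFinrank + eF) := fun i => i.cast heq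
  have hg : Function.Surjective g := fun j => ⟨j.cast heq.symm, by simp [g]⟩
  let u' : Fin (maximalIdeal (P.presheaf.stalk p)).spanFinrank → P.presheaf.stalk p :=
    Fin.append (φ ∘ u) wl ∘ g
  have hu'cast : ∀ i : Fin (maximalIdeal (Y.presheaf.stalk (fst p))).spanFinrank,
      u' ((Fin.castAdd eF i).cast heq.symm) = φ (u i) := by
    intro i
    change Fin.append (φ ∘ u) wl (((Fin.castAdd eF i).cast heq.symm).cast heq) = _
    have hcc : ((Fin.castAdd eF i).cast heq.symm).cast heq = Fin.castAdd eF i := by simp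
    rw [hcc, Fin.append_left]
    rfl
  refine ⟨hBreg, u', ?_, ?_, ?_⟩
  · -- `span (range u') = 𝔪_B`
    change Ideal.span (Set.range (Fin.append (φ ∘ u) wl ∘ g)) = _
    rw [hg.range_comp]
    exact hgen
  · -- the divisors through `p`
    -- choose, for each pulled-back member through `p`, a member of `E` it comes from
    have hex : ∀ D' : {D' // D' ∈ (E.map fun D => D.comap fst) ∧ p ∈ D'.support},
        ∃ D : Y.IdealSheafData, D ∈ E ∧ D.comap fst = D'.1 := fun D' => List.mem_map.1 D'.2.1
    choose Dof hDofE hDof using hex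
    have hmem : ∀ D' : {D' // D' ∈ (E.map fun D => D.comap fst) ∧ p ∈ D'.support},
        fst p ∈ (Dof D').support := by
      intro D'
      have h1 : p ∈ ((Dof D').comap fst).support := by rw [hDof D']; exact D'.2.2
      rw [Scheme.IdealSheafData.support_comap] at h1
      exact h1
    refine ⟨fun D' => (Fin.castAdd eF (ι ⟨Dof D', hDofE D', hmem D'⟩)).cast heq.symm, ?_, ?_⟩
    · intro D₁ D₂ h12
      have h1 : Fin.castAdd eF (ι ⟨Dof D₁, hDofE D₁, hmem D₁⟩) =
          Fin.castAdd eF (ι ⟨Dof D₂, hDofE D₂, hmem D₂⟩) := Fin.cast_injective heq.symm h12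
      have h2 := hι (Fin.castAdd_injective _ _ h1)
      have h3 : Dof D₁ = Dof D₂ := congrArg (fun D : {D // D ∈ E ∧ fst p ∈ D.support} => D.1) h2
      apply Subtype.ext
      rw [← hDof D₁, ← hDof D₂, h3]
    · intro D'
      rw [hu'cast]
      have h1 : stalkIdeal D'.1 p = stalkIdeal ((Dof D').comap fst) p := by rw [hDof D']
      rw [h1, stalkIdeal_comap_eq_map_stalkMap, hιD ⟨Dof D', hDofE D', hmem D'⟩, Ideal.map_span,
        Set.image_singleton]
      rfl
  · -- the centre
    intro hp
    have hp' : fst p ∈ C.support := by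
      rw [Scheme.IdealSheafData.support_comap] at hp
      exact hp
    obtain ⟨S, hS⟩ := hC hp'
    refine ⟨(fun i : Fin (maximalIdeal (Y.presheaf.stalk (fst p))).spanFinrank =>
      (Fin.castAdd eF i).cast heq.symm) '' S, ?_⟩
    rw [stalkIdeal_comap_eq_map_stalkMap, hS, Ideal.map_span, Set.image_image, Set.image_image]
    congr 1
    refine Set.image_congr' fun i => ?_
    rw [hu'cast]
    rfl

/-- **Simple normal crossings (no centre) are stable under extension of a perfect base field**:
the case `C = ⊤` of `HasSNCWith.comap_pullback_fst_field` (`⊤` pulls back to `⊤`).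
[cite: Matsumura1987, Thm. 15.1 and Thm. 23.7] -/
theorem HasSNC.comap_pullback_fst_field {E : List Y.IdealSheafData} (h : HasSNC E) :
    HasSNC (E.map fun D => D.comap (pullback.fst q (specOfAlgebra k K))) := by
  have h1 := HasSNCWith.comap_pullback_fst_field q K h
  rwa [Scheme.IdealSheafData.comap_top] at h1

end SNCBaseChange

end Literature.AlgebraicGeometry.Resolution

end
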